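/-
Copyright (c) 2026 the pub-hodgecm-mathlib formalisation cell (harness21).  Prover seat hodgecm-mathlib-K2Liu-p08 (g5), Track B «K2-LIT»,
#184♮ = hLiu418 = `stmt-HodgeConjecture-24832`; #42S organ S1 (local Siegel–Weil spanning), SPLIT HAND, the (C3)-BYTES-INDEPENDENT layers of the split
evaluation brick `K2LiuSplitWitnessMiddleProfileRow` (LEAD F0P6-plan (g14) BATCH #64∕#65: (C3) = K2Liu-p26 (g2); split evaluation = K2Liu-p08 (g5)).
-/
import Summits.HodgeConjecture.HodgeConjecture.Theorems.K2LiuSplitMiddleProfileFactorisation  -- ★ (M2b)-split `factorisation_of_splitMiddleProfile`, `…_balls`, `splitMiddleRows_of_balls` (p08)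
import Summits.HodgeConjecture.HodgeConjecture.Theorems.K2LiuSplitWitnessLeviReading          -- ★ (M2a-L)-split + ★ `exists_row_exponent` (p01) (p08)
import Summits.HodgeConjecture.HodgeConjecture.Theorems.K2LiuLocalRingSplitReading            -- ★ the `(w₀, w̄₀)`-reading of `E ⊗ F_v` (p08)
import Summits.HodgeConjecture.HodgeConjecture.Theorems.K2LiuLocalRingPlaceDecomposition      -- ★ (R4) `exists_addHaar_eq_smul_map`
import Literature.NumberTheory.Automorphic.AdicCompletionDegreeOnePlaceEquiv                  -- ★ `adicCompletionEquivOfDegreeOne`, `ramificationIdx_eq_one_and_inertiaDeg_eq_one_of_smul_ne`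
import Literature.NumberTheory.Automorphic.UnitaryGroupLocalFactors                          -- ★ `continuous_conjLocal`
import HarnessLib

/-!
# Crux `HLiu418`, #42S organ S1, SPLIT HAND: TRANSPORT LAYERS OF THE SPLIT MIDDLE-PROFILE ROW —
# `E ⊗ F_v ≃ K × K`, Haar transport `∫ (g ∘ θ) dμ_v = c_θ · ∫ g dμ_K`, the phase `ψ_v ↦ Ψ_x` on `K = E_{w₀}`, and the two-depth rows with a possibly trivial phase

Cell `hodgecm-mathlib`, crux item hLiu418 = `stmt-HodgeConjecture-24832`; squad K2 ∕ K2Liu; LEAD F0P6-plan (g14); prover K2Liu-p08 (g5).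
THEOREMS ONLY (no `def`, no instance, no notation, no named-fact hypothesis, no `sorry`); lane `--supports stmt-HodgeConjecture-24832 --as helper`.

WHY.  The split face of record ★ `K2LiuLocalSWSpanningSplitOfMoverMiddleRowsGeneral` waits on ONE letter `hmid` (the two-depth middle rows).  Its payer composes
the (M2a) chain's (C3) Levi-row head (K2Liu-p26 (g2): `F_Ψ(w₁·x) = c·χ(x)·∫_y ψ_v(s_x·q(y))·(Γ′Ψ)(pt_x y) dμ_v`, Levi-row point in `E ⊗ F_v`-letters) with the
split reading.  THIS FILE is everything of that composition which does NOT depend on the (C3) bytes, at a place `v` SPLIT in `E` (`c • w₀ ≠ w₀`, `K := E_{w₀}`):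
§1 the reading `(Fin 3 → E ⊗ F_v) ≃ₜ ((K × K) × (K × K)) × (K × K)`, `u ↦ (((u 1)′, (u 1)″), ((u 2)′, (u 2)″)), ((u 0)′, (u 0)″))` (`z′ = z(w₀)`, `z″ = (σz)(w₀)`;
the variable order `((β, γ), α)` of ★ (M2b)-split), additive, and the frame change `u ↦ u ᵥ* Q`; §2 Haar transport (★ (R4) `exists_addHaar_eq_smul_map` as an
integral identity `∫ g(e a) dμ_A = c · ∫ g dμ_R`, ONE `c > 0` for all `g`); §3 the phase on `K`: `ι_{w₀} : F_v ≃+* K` (★ `adicCompletionEquivOfDegreeOne`),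
`Ψ_s := (ψ_v ∘ (s·)) ∘ ι_{w₀}⁻¹` with `Ψ_s(ι_{w₀} a) = ψ_v(s a)`, continuous, `Ψ_0 = 1`; the norm form reads `(ασβ + βσα + γσγ)′ = α′β″ + α″β′ + γ′γ″`; §4 if the
three `κ`-blocks of a point are the column `i₀` of `D` times `(α, β, γ)` (★ (C3-κ) `kappa_levi_rows`) then `κ′` (the ED. 5 letter `hκ′`) is the six-block Levi row
`(β″a″, β′a′, α′a′, α″a″, γ′a′, γ″a″)`, `a′ j = (D j i₀)′`, `a″ j = (D j i₀)″`, and these rows are non-zero for invertible `D`; `hπw` is automatic at a split place;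
§5 `splitMiddleRows_of_balls_or_one`: ★ `splitMiddleRows_of_balls` with the phase allowed to be TRIVIAL (Levi-type `x`, `s_x = 0`: plain product of measures;
else a conductor exponent from ★ `AddChar.IsContinuousNontrivial.exists_hasConductorExp`).
References: [WeilBNT1967] Ch. II §5 Prop. 12, Ch. VII §2; [Tate1950] §2.2; [CasselsFrohlichANT1967] Ch. II §10, Ch. VII §1.1; [FrohlichTaylor1990] Ch. III §1 (1.14)(a);
[Kudla1994] §3 Thm. 3.1; [KudlaSweet1997] §1.
HONEST LABEL.  Count-neutral helper: `HC_CM` is proved only modulo the 7 printed citations (2 remaining named inputs: hLiu418 = `stmt-HodgeConjecture-24832`,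
h413 = `stmt-HodgeConjecture-24833`) until rung 0 closes.  NOT here: the (C3) head (K2Liu-p26), the assembly `K2LiuSplitWitnessMiddleProfileRow` ⇒ `hmid`, the closing file.

## References
* [WeilBNT1967] A. Weil, *Basic Number Theory* (1967), Ch. II §5 Prop. 12; Ch. VII §2.  * [Tate1950] J. Tate, thesis (1950), §2.2.
* [CasselsFrohlichANT1967] Cassels–Fröhlich (eds.), *Algebraic Number Theory* (1967), Ch. II §10; Ch. VII §1.1.  * [FrohlichTaylor1990] Fröhlich–Taylor, Ch. III §1 (1.14)(a).
* [Kudla1994] S. S. Kudla, Israel J. Math. 87 (1994), §3 Thm. 3.1.  * [KudlaSweet1997] S. S. Kudla, W. J. Sweet, Israel J. Math. 98 (1997), §1.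
-/

set_option autoImplicit false
set_option linter.dupNamespace false -- the mandated namespace repeats `HodgeConjecture.HodgeConjecture`

noncomputable section

open NumberField IsDedekindDomain MeasureTheory Set Matrix
open scoped NNReal ENNReal
open Literature.NumberTheory.Automorphic Literature.NumberTheory.Automorphic.UnitaryGroup
open Literature.NumberTheory.Automorphic.LocalFieldHaar
open Literature.NumberTheory.GaloisRepresentations Literature.NumberTheory.GaloisRepresentations.IsNonarchimedeanLocalField
open Summit.HodgeConjecture.HodgeConjecture.Cruxes.HLiu418.K2LiuLocalRingSplitReading
open Summit.HodgeConjecture.HodgeConjecture.Cruxes.HLiu418.K2LiuLocalRingPlaceDecomposition (exists_addHaar_eq_smul_map)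
open Summit.HodgeConjecture.HodgeConjecture.Cruxes.HLiu418.K2LiuWitnessLeviReading (exists_row_exponent)
open Summit.HodgeConjecture.HodgeConjecture.Cruxes.HLiu418.K2LiuSplitMiddleProfileFactorisation

namespace Summit.HodgeConjecture.HodgeConjecture.Cruxes.HLiu418.K2LiuSplitMiddleProfileTransport

/-! ## §1 The split reading of `(E ⊗ F_v)³` and the frame change as additive homeomorphisms -/

section Reading

variable {F E : Type} [Field F] [NumberField F] [Field E] [NumberField E] [Algebra F E] [Algebra.IsQuadraticExtension F E]
  (c : E ≃ₐ[F] E) {δ : E} (hcδ : c δ = -δ) (hδ : δ ≠ 0) (v : HeightOneSpectrum (𝓞 F))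
  (w₀ : PlacesOver E v) (hw₀ : c • w₀.1 ≠ w₀.1)

include hcδ hδ hw₀ in
/-- **THE READING `z ↦ (z′, z″)` OF `E ⊗ F_v` AS A HOMEOMORPHISM onto `K × K`** (`K = E_{w₀}`): bijective by ★ `reading_injective` ∕ `reading_surjective`, continuous
(evaluation and `σ` ★ `continuous_conjLocal`), with the continuous inverse `(a, b) ↦ δ_{w₀} a + σ(δ_{w₀} b)`; additive. [cite: CasselsFrohlichANT1967, Ch. II §10] -/
theorem exists_homeomorph_reading :
    ∃ r : LocalRing E v ≃ₜ (w₀.1.adicCompletion E × w₀.1.adicCompletion E),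
      (∀ z, r z = (z w₀, conjLocal E c v z w₀)) ∧ ∀ z z', r (z + z') = r z + r z' := by
  classical
  have hne : PlacesOver.galInv c w₀ ≠ w₀ := PlacesOver.galInv_ne c w₀ hw₀
  -- the candidate inverse
  let inv : (w₀.1.adicCompletion E × w₀.1.adicCompletion E) → LocalRing E v := fun p =>
    Pi.single (M := fun w : PlacesOver E v => w.1.adicCompletion E) w₀ p.1 +
      conjLocal E c v (Pi.single (M := fun w : PlacesOver E v => w.1.adicCompletion E) w₀ p.2)
  have hsingle0 : ∀ a : w₀.1.adicCompletion E,
      (Pi.single (M := fun w : PlacesOver E v => w.1.adicCompletion E) w₀ a) (PlacesOver.galInv c w₀) = 0 := fun a =>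
    Pi.single_eq_of_ne (M := fun w : PlacesOver E v => w.1.adicCompletion E) hne a
  have hsingle : ∀ a : w₀.1.adicCompletion E, (Pi.single (M := fun w : PlacesOver E v => w.1.adicCompletion E) w₀ a) w₀ = a := fun a =>
    Pi.single_eq_same (M := fun w : PlacesOver E v => w.1.adicCompletion E) w₀ a
  have hσsingle : ∀ a : w₀.1.adicCompletion E, conjLocal E c v (Pi.single (M := fun w : PlacesOver E v => w.1.adicCompletion E) w₀ a) w₀ = 0 := by
    intro a
    rw [conjLocal_apply]
    have h0 : (Pi.single (M := fun w : PlacesOver E v => w.1.adicCompletion E) w₀ a) ⟨c⁻¹ • w₀.1, under_inv_smul_eq c w₀⟩ = 0 := hsingle0 a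
    rw [h0, map_zero]
  have hright : ∀ p, ((inv p) w₀, conjLocal E c v (inv p) w₀) = p := by
    rintro ⟨a, b⟩
    refine Prod.ext ?_ ?_
    · show (Pi.single (M := fun w : PlacesOver E v => w.1.adicCompletion E) w₀ a +
          conjLocal E c v (Pi.single (M := fun w : PlacesOver E v => w.1.adicCompletion E) w₀ b)) w₀ = a
      rw [Pi.add_apply, hσsingle, add_zero, hsingle]
    · show conjLocal E c v (Pi.single (M := fun w : PlacesOver E v => w.1.adicCompletion E) w₀ a +
          conjLocal E c v (Pi.single (M := fun w : PlacesOver E v => w.1.adicCompletion E) w₀ b)) w₀ = b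
      rw [map_add, conjLocal_conjLocal c v hcδ hδ, Pi.add_apply, hσsingle, zero_add, hsingle]
  have hleft : ∀ z, inv (z w₀, conjLocal E c v z w₀) = z := by
    intro z
    apply reading_injective c v w₀ hw₀
    exact Prod.ext (congrArg Prod.fst (hright (z w₀, conjLocal E c v z w₀))) (congrArg Prod.snd (hright (z w₀, conjLocal E c v z w₀)))
  let e : LocalRing E v ≃ (w₀.1.adicCompletion E × w₀.1.adicCompletion E) :=
    { toFun := fun z => (z w₀, conjLocal E c v z w₀), invFun := inv, left_inv := hleft, right_inv := hright }
  have hcont : Continuous e :=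
    (continuous_apply w₀).prodMk ((continuous_apply w₀).comp (continuous_conjLocal E c v))
  have hcont_single : Continuous fun a : w₀.1.adicCompletion E => Pi.single (M := fun w : PlacesOver E v => w.1.adicCompletion E) w₀ a := by
    refine continuous_pi fun w => ?_
    by_cases hw : w = w₀
    · subst hw
      simp only [Pi.single_eq_same]
      exact continuous_id
    · simp only [Pi.single_eq_of_ne hw]
      exact continuous_const
  have hcont' : Continuous e.symm :=
    (hcont_single.comp continuous_fst).add ((continuous_conjLocal E c v).comp (hcont_single.comp continuous_snd))
  refine ⟨⟨e, hcont, hcont'⟩, fun z => rfl, fun z z' => ?_⟩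
  show ((z + z') w₀, conjLocal E c v (z + z') w₀) = (z w₀, conjLocal E c v z w₀) + (z' w₀, conjLocal E c v z' w₀)
  rw [map_add]
  rfl

include hcδ hδ hw₀ in
/-- **THE SPLIT READING OF THE THREE FRAME COORDINATES**, in the variable order `((β, γ), α) ↦ (((β′, β″), (γ′, γ″)), (α′, α″))` of ★ (M2b)-split
`setIntegral_splitMiddleProfile_balls`: an additive homeomorphism `(Fin 3 → E ⊗ F_v) ≃ₜ ((K × K) × (K × K)) × (K × K)` (index `0 = α`, `1 = β`, `2 = γ`).
[cite: CasselsFrohlichANT1967, Ch. II §10] -/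
theorem exists_homeomorph_reading3 :
    ∃ Θ : (Fin 3 → LocalRing E v) ≃ₜ (((w₀.1.adicCompletion E × w₀.1.adicCompletion E) × (w₀.1.adicCompletion E × w₀.1.adicCompletion E)) ×
        (w₀.1.adicCompletion E × w₀.1.adicCompletion E)),
      (∀ u, Θ u = (((u 1 w₀, conjLocal E c v (u 1) w₀), (u 2 w₀, conjLocal E c v (u 2) w₀)), (u 0 w₀, conjLocal E c v (u 0) w₀))) ∧
      ∀ u u', Θ (u + u') = Θ u + Θ u' := by
  obtain ⟨r, hr, hradd⟩ := exists_homeomorph_reading c hcδ hδ v w₀ hw₀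
  -- `u ↦ ((r (u 1), r (u 2)), r (u 0))`
  let e : (Fin 3 → LocalRing E v) ≃ (((w₀.1.adicCompletion E × w₀.1.adicCompletion E) × (w₀.1.adicCompletion E × w₀.1.adicCompletion E)) ×
      (w₀.1.adicCompletion E × w₀.1.adicCompletion E)) :=
    { toFun := fun u => ((r (u 1), r (u 2)), r (u 0))
      invFun := fun p => ![r.symm p.2, r.symm p.1.1, r.symm p.1.2]
      left_inv := fun u => by
        funext i
        fin_cases i
        · simp only [Homeomorph.symm_apply_apply, Fin.zero_eta, Matrix.cons_val_zero]
        · simp only [Homeomorph.symm_apply_apply, Fin.mk_one, Matrix.cons_val_one, Matrix.cons_val_zero]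
        · simp only [Homeomorph.symm_apply_apply, Fin.reduceFinMk, Matrix.cons_val]
      right_inv := fun p => by
        simp only [Matrix.cons_val_one, Matrix.cons_val_zero, Homeomorph.apply_symm_apply, Matrix.cons_val] }
  have hcont : Continuous e :=
    ((r.continuous.comp (continuous_apply 1)).prodMk (r.continuous.comp (continuous_apply 2))).prodMk (r.continuous.comp (continuous_apply 0))
  have hcont' : Continuous fun p : (((w₀.1.adicCompletion E × w₀.1.adicCompletion E) × (w₀.1.adicCompletion E × w₀.1.adicCompletion E)) ×
      (w₀.1.adicCompletion E × w₀.1.adicCompletion E)) => (![r.symm p.2, r.symm p.1.1, r.symm p.1.2] : Fin 3 → LocalRing E v) := by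
    refine continuous_pi fun i => ?_
    fin_cases i
    · simp only [Fin.zero_eta, Matrix.cons_val_zero]
      exact r.symm.continuous.comp continuous_snd
    · simp only [Fin.mk_one, Matrix.cons_val_one, Matrix.cons_val_zero]
      exact r.symm.continuous.comp (continuous_fst.comp continuous_fst)
    · simp only [Fin.reduceFinMk, Matrix.cons_val]
      exact r.symm.continuous.comp (continuous_snd.comp continuous_fst)
  refine ⟨⟨e, hcont, hcont'⟩, fun u => ?_, fun u u' => ?_⟩
  · show ((r (u 1), r (u 2)), r (u 0)) = _
    rw [hr, hr, hr]
  · show ((r ((u + u') 1), r ((u + u') 2)), r ((u + u') 0)) = ((r (u 1), r (u 2)), r (u 0)) + ((r (u' 1), r (u' 2)), r (u' 0))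
    simp only [Pi.add_apply, hradd, Prod.mk_add_mk]

omit [NumberField F] [Algebra.IsQuadraticExtension F E] in
/-- **THE FRAME CHANGE `u ↦ u ᵥ* Q` IS AN ADDITIVE HOMEOMORPHISM** of `Fin 3 → E ⊗ F_v` for `Q` invertible (inverse `u ↦ u ᵥ* Q⁻¹`; both polynomial, hence
continuous). [folklore] -/
theorem exists_homeomorph_vecMul {n : ℕ} (Q : Matrix (Fin n) (Fin n) (LocalRing E v)) (hQ : IsUnit Q.det) :
    ∃ φ : (Fin n → LocalRing E v) ≃ₜ (Fin n → LocalRing E v), (∀ u, φ u = u ᵥ* Q) ∧ ∀ u u', φ (u + u') = φ u + φ u' := by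
  have hcQ : ∀ M : Matrix (Fin n) (Fin n) (LocalRing E v), Continuous fun u : Fin n → LocalRing E v => u ᵥ* M := fun M =>
    continuous_pi fun j => by
      simp only [Matrix.vecMul, dotProduct]
      exact continuous_finsetSum _ fun i _ => (continuous_apply i).mul continuous_const
  let e : (Fin n → LocalRing E v) ≃ (Fin n → LocalRing E v) :=
    { toFun := fun u => u ᵥ* Q, invFun := fun u => u ᵥ* Q⁻¹
      left_inv := fun u => by simp only [Matrix.vecMul_vecMul, Matrix.mul_nonsing_inv _ hQ, Matrix.vecMul_one]
      right_inv := fun u => by simp only [Matrix.vecMul_vecMul, Matrix.nonsing_inv_mul _ hQ, Matrix.vecMul_one] }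
  exact ⟨⟨e, hcQ Q, hcQ Q⁻¹⟩, fun u => rfl, fun u u' => Matrix.add_vecMul Q u u'⟩

end Reading

/-! ## §2 Haar transport along an additive homeomorphism, as an integral identity -/
/-- **HAAR TRANSPORT OF INTEGRALS**: for an additive homeomorphism `e : A ≃ₜ R` between locally compact second countable abelian groups and Haar measures
`μ_A`, `μ_R`, there is ONE `c > 0` with `∫ g(e a) dμ_A(a) = c · ∫ g dμ_R` for every `g : R → ℂ` (no integrability needed: both sides vanish together).  ★ (R4)
`exists_addHaar_eq_smul_map` gives `μ_R = c_R • e_* μ_A`; then `∫ g dμ_R = c_R ∫ (g ∘ e) dμ_A`. [cite: WeilBNT1967, Ch. II §5, Prop. 12] -/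
theorem exists_integral_comp_eq_mul {A R : Type*} [AddCommGroup A] [TopologicalSpace A] [IsTopologicalAddGroup A] [MeasurableSpace A] [BorelSpace A]
    [AddCommGroup R] [TopologicalSpace R] [IsTopologicalAddGroup R] [MeasurableSpace R] [BorelSpace R] [LocallyCompactSpace R] [SecondCountableTopology R]
    (e : A ≃ₜ R) (hadd : ∀ p p' : A, e (p + p') = e p + e p')
    (μA : Measure A) [μA.IsAddHaarMeasure] (μR : Measure R) [μR.IsAddHaarMeasure] :
    ∃ c : ℝ, 0 < c ∧ ∀ g : R → ℂ, ∫ a, g (e a) ∂μA = c * ∫ r, g r ∂μR := by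
  obtain ⟨cR, hcR, hμ⟩ := exists_addHaar_eq_smul_map e hadd μA μR
  have hcR' : (0 : ℝ) < cR := by exact_mod_cast hcR
  refine ⟨((cR : ℝ))⁻¹, inv_pos.2 hcR', fun g => ?_⟩
  have h1 : ∫ r, g r ∂μR = (cR : ℂ) * ∫ a, g (e a) ∂μA := by
    rw [hμ, integral_smul_measure, integral_map_equiv, Homeomorph.toMeasurableEquiv_coe, ENNReal.coe_toReal, Complex.real_smul]
  have hc0 : ((cR : ℝ) : ℂ) ≠ 0 := by exact_mod_cast hcR'.ne'
  rw [h1, ← mul_assoc, Complex.ofReal_inv, inv_mul_cancel₀ hc0, one_mul]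

/-! ## §3 The phase on `K = E_{w₀}`: transport of `ψ_v` along `ι_{w₀} : F_v ≃ K`, and the norm form in the reading -/

section Phase

variable {F E : Type} [Field F] [NumberField F] [Field E] [NumberField E] [Algebra F E] [Algebra.IsQuadraticExtension F E]
  (c : E ≃ₐ[F] E) {δ : E} (hcδ : c δ = -δ) (hδ : δ ≠ 0) (v : HeightOneSpectrum (𝓞 F))
  (w₀ : PlacesOver E v) (hw₀ : c • w₀.1 ≠ w₀.1)

include hw₀ in
/-- **`ι_{w₀} : F_v → K` IS ONTO AT A SPLIT PLACE** (degree one: `e = f = 1`, ★ `ramificationIdx_eq_one_and_inertiaDeg_eq_one_of_smul_ne` +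
★ `bijective_adicCompletionOfLiesOver_of_degree_one`). [cite: FrohlichTaylor1990, Ch. III §1 (1.14)(a)] -/
theorem toPlace_bijective_of_smul_ne : Function.Bijective (toPlace v w₀) := by
  obtain ⟨he, hf⟩ := ramificationIdx_eq_one_and_inertiaDeg_eq_one_of_smul_ne F c hw₀
  haveI := PlacesOver.liesOver w₀
  exact bijective_adicCompletionOfLiesOver_of_degree_one F E v w₀.1 he hf

include hw₀ in
/-- **`hπw` IS AUTOMATIC AT A SPLIT PLACE**: `v_{w₀}(ι_{w₀} π) = v_v(π)` (`e(w₀|v) = 1`, ★ `valued_toPlace` + ★ `ramificationIdx'_eq_one_of_smul_ne`); in particular a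
uniformiser of `F_v` stays a uniformiser of `K`. [cite: CasselsFrohlichANT1967, Ch. II §10] -/
theorem valued_toPlace_of_smul_ne (y : v.adicCompletion F) : Valued.v (toPlace v w₀ y) = Valued.v y := by
  have he := ramificationIdx'_eq_one_of_smul_ne F c hw₀
  have h2 : w₀.1.under (𝓞 F) = v := w₀.2
  rw [h2] at he
  rw [valued_toPlace, he, pow_one]

include hw₀ in
/-- `v_{w₀}(ι_{w₀} π) = exp(−1)` for a uniformiser `π` of `F_v` at a split place — the letter `hπw` of ★ (M2a-L)-split ∕ ★ `exists_row_exponent`.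
[cite: CasselsFrohlichANT1967, Ch. II §10] -/
theorem valued_toPlace_uniformizer_of_smul_ne {π : v.adicCompletion F} (hπ : Valued.v π = WithZero.exp (-1 : ℤ)) :
    Valued.v (toPlace v w₀ π) = WithZero.exp (-1 : ℤ) := by
  rw [valued_toPlace_of_smul_ne c v w₀ hw₀, hπ]

include hw₀ in
/-- **THE PHASE ON `K`**: for a character `ψ` of `F_v` there is a family `s ↦ Ψ_s` of additive characters of `K = E_{w₀}` with `Ψ_s(ι_{w₀} a) = ψ(s·a)`
(`Ψ_s := (ψ ∘ (s·)) ∘ ι_{w₀}⁻¹`, `ι_{w₀}` bijective at a split place), `Ψ_s` continuous when `ψ` is, and `Ψ_0 = 1`.  No `def`: an existence statement.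
[cite: Tate1950, §2.2] [cite: FrohlichTaylor1990, Ch. III §1 (1.14)(a)] -/
theorem exists_addChar_transport (ψ : AddChar (v.adicCompletion F) Circle) (hψ : Continuous ψ) :
    ∃ Ψ : v.adicCompletion F → AddChar (w₀.1.adicCompletion E) Circle,
      (∀ s a, Ψ s (toPlace v w₀ a) = ψ (s * a)) ∧ (∀ s, Continuous (Ψ s)) ∧ Ψ 0 = 1 := by
  obtain ⟨he, hf⟩ := ramificationIdx_eq_one_and_inertiaDeg_eq_one_of_smul_ne F c hw₀
  haveI := PlacesOver.liesOver w₀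
  let ι : v.adicCompletion F ≃+* w₀.1.adicCompletion E := adicCompletionEquivOfDegreeOne F E v w₀.1 he hf
  have hι : ∀ a, ι a = toPlace v w₀ a := fun a => rfl
  have hιc : Continuous ι.symm := by
    have h := (adicCompletionHomeomorphOfDegreeOne F E v w₀.1 he hf).symm.continuous
    rw [← adicCompletionEquivOfDegreeOne_symm_eq] at h
    exact h
  refine ⟨fun s => (ψ.mulShift s).compAddMonoidHom (ι.symm : w₀.1.adicCompletion E →+* v.adicCompletion F).toAddMonoidHom,
    fun s a => ?_, fun s => ?_, ?_⟩
  · rw [AddChar.compAddMonoidHom_apply, RingHom.toAddMonoidHom_eq_coe, AddMonoidHom.coe_coe, RingEquiv.coe_toRingHom, ← hι,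
      RingEquiv.symm_apply_apply, AddChar.mulShift_apply]
  · exact (hψ.comp (continuous_const.mul continuous_id)).comp hιc
  · ext z
    rw [AddChar.compAddMonoidHom_apply, AddChar.mulShift_apply, zero_mul, AddChar.map_zero_eq_one, AddChar.one_apply]

omit [Algebra.IsQuadraticExtension F E] in
/-- **THE NORM FORM IN THE READING**: `(α·σβ + β·σα + γ·σγ)(w₀) = α′β″ + α″β′ + γ′γ″` (`z′ = z(w₀)`, `z″ = (σz)(w₀)`; ★ `reading_mul_conjLocal`).
[cite: CasselsFrohlichANT1967, Ch. VII §1.1] -/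
theorem reading_hermitian_three (α β γ : LocalRing E v) :
    (α * conjLocal E c v β + β * conjLocal E c v α + γ * conjLocal E c v γ) w₀ =
      α w₀ * conjLocal E c v β w₀ + conjLocal E c v α w₀ * β w₀ + γ w₀ * conjLocal E c v γ w₀ := by
  simp only [Pi.add_apply, Pi.mul_apply]
  ring

omit [Algebra.IsQuadraticExtension F E] in
/-- a base scalar reads through `ι_{w₀}`: `(ι_v q)(w₀) = ι_{w₀} q` (★ `toLocalRing_apply`). [folklore] -/
theorem toLocalRing_apply_w₀ (q : v.adicCompletion F) : toLocalRing E v q w₀ = toPlace v w₀ q := toLocalRing_apply E v q w₀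

omit [Algebra.IsQuadraticExtension F E] in
/-- **THE PHASE IDENTITY**: if the (C3) head's quadratic letter `q ∈ F_v` satisfies `ι_v q = α·σβ + β·σα + γ·σγ` in `E ⊗ F_v`, then for the transported character
`Ψ_s(ι_{w₀} a) = ψ(s a)`: `ψ(s·q) = Ψ_s(α′β″ + α″β′ + 1·γ′γ″)` — the integrand of ★ (M2b)-split with `D = 1`. [cite: Kudla1994, §3 Thm. 3.1] [cite: Tate1950, §2.2] -/
theorem phase_eq_of_toLocalRing_eq (ψ : AddChar (v.adicCompletion F) Circle) (Ψ : AddChar (w₀.1.adicCompletion E) Circle) {s : v.adicCompletion F}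
    (hΨ : ∀ a, Ψ (toPlace v w₀ a) = ψ (s * a)) {q : v.adicCompletion F} {α β γ : LocalRing E v}
    (hq : toLocalRing E v q = α * conjLocal E c v β + β * conjLocal E c v α + γ * conjLocal E c v γ) :
    ψ (s * q) = Ψ (α w₀ * conjLocal E c v β w₀ + conjLocal E c v α w₀ * β w₀ + 1 * (γ w₀) * conjLocal E c v γ w₀) := by
  have h1 : toPlace v w₀ q = α w₀ * conjLocal E c v β w₀ + conjLocal E c v α w₀ * β w₀ + γ w₀ * conjLocal E c v γ w₀ := by
    rw [← toLocalRing_apply_w₀ v w₀ q, hq]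
    exact reading_hermitian_three c v w₀ α β γ
  rw [← hΨ, h1, one_mul]

end Phase

/-! ## §4 The split Levi row through the coordinate letters of ED. 5 -/

section LeviRow

variable {F E : Type} [Field F] [NumberField F] [Field E] [NumberField E] [Algebra F E]
  (c : E ≃ₐ[F] E) (v : HeightOneSpectrum (𝓞 F)) (w₀ : PlacesOver E v)

/-- **THE SPLIT READING OF A LEVI-ROW POINT**: if the three `κ`-blocks of `z` are `(D j i₀ · α)_j`, `(D j i₀ · β)_j`, `(D j i₀ · γ)_j` (the column `i₀` of the
`Δ⁻`-block `D` of the Siegel element, ★ (C3-κ) `kappa_levi_rows`) and `κ′` is the split reading of `κ` (the ED. 5 letter `hκ′`), then `κ′ z` is the six-block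
Levi row `(β″a″, β′a′, α′a′, α″a″, γ′a′, γ″a″)` of ★ (M2a-L)-split `indicator_box6One_sub_box6Two_levi_eq_indicator_primePowBall`, with
`a′ j = (D j i₀)(w₀)`, `a″ j = (σ(D j i₀))(w₀)`. [cite: Kudla1994, §3 Thm. 3.1] [cite: HarrisKudlaSweet1996, §1 (1.15)] -/
theorem splitReading_leviRow {X : Type*} (κ : X → ((Fin 2 → LocalRing E v) × (Fin 2 → LocalRing E v) × (Fin 2 → LocalRing E v)))
    (κ' : X → ((Fin 2 → w₀.1.adicCompletion E) × (Fin 2 → w₀.1.adicCompletion E) × (Fin 2 → w₀.1.adicCompletion E) ×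
      (Fin 2 → w₀.1.adicCompletion E) × (Fin 2 → w₀.1.adicCompletion E) × (Fin 2 → w₀.1.adicCompletion E)))
    (hκ' : ∀ x, κ' x = (fun j => conjLocal E c v ((κ x).2.1 j) w₀, fun j => (κ x).2.1 j w₀, fun j => (κ x).1 j w₀,
        fun j => conjLocal E c v ((κ x).1 j) w₀, fun j => (κ x).2.2 j w₀, fun j => conjLocal E c v ((κ x).2.2 j) w₀))
    (D : Matrix (Fin 2) (Fin 2) (LocalRing E v)) (i₀ : Fin 2) {z : X} {α β γ : LocalRing E v}
    (h1 : (κ z).1 = fun j => D j i₀ * α) (h2 : (κ z).2.1 = fun j => D j i₀ * β) (h3 : (κ z).2.2 = fun j => D j i₀ * γ) :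
    κ' z = (fun j => conjLocal E c v β w₀ * conjLocal E c v (D j i₀) w₀, fun j => β w₀ * D j i₀ w₀, fun j => α w₀ * D j i₀ w₀,
      fun j => conjLocal E c v α w₀ * conjLocal E c v (D j i₀) w₀, fun j => γ w₀ * D j i₀ w₀, fun j => conjLocal E c v γ w₀ * conjLocal E c v (D j i₀) w₀) := by
  rw [hκ' z, h1, h2, h3]
  simp only [map_mul, Pi.mul_apply, mul_comm]

/-- **THE ROWS `a′`, `a″` OF AN INVERTIBLE `D` ARE NON-ZERO**: if `D` is invertible over `E ⊗ F_v` then the readings at `w₀` and through `σ` of any column are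
non-zero vectors of `K²` (a column of an invertible matrix over the field `K = E_{w₀}`, resp. of `σ(D)`, is non-zero). [folklore] -/
theorem col_reading_ne_zero (D : Matrix (Fin 2) (Fin 2) (LocalRing E v)) (hD : IsUnit D.det) (i₀ : Fin 2) :
    (fun j => D j i₀ w₀) ≠ 0 ∧ (fun j => conjLocal E c v (D j i₀) w₀) ≠ 0 := by
  -- evaluation at `w₀` and `σ` are ring homs; the images of `D` are invertible over the field `K`
  have key : ∀ (f : LocalRing E v →+* w₀.1.adicCompletion E), (fun j => f (D j i₀)) ≠ 0 := by
    intro f hzero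
    have hdet : IsUnit (D.map f).det := by
      have h := hD.map f
      rwa [RingHom.map_det, RingHom.mapMatrix_apply] at h
    have hcol : ∀ j, (D.map f) j i₀ = 0 := fun j => congrFun hzero j
    have : (D.map f).det = 0 := Matrix.det_eq_zero_of_column_eq_zero i₀ hcol
    exact (hdet.ne_zero this).elim
  exact ⟨key (Pi.evalRingHom _ w₀), key ((Pi.evalRingHom _ w₀).comp (conjLocal E c v))⟩

end LeviRow

/-! ## §5 The two-depth rows with a possibly trivial phase -/

section Rows

variable {K : Type*} [Field K] [ValuativeRel K] [TopologicalSpace K] [IsNonarchimedeanLocalField K]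
  [MeasurableSpace K] [BorelSpace K] (μ : Measure K) [μ.IsAddHaarMeasure]
variable {H : Type*} [Mul H] (Pred : H → Prop)

open scoped Classical in
/-- **THE SPLIT MIDDLE PROFILE IN `𝔭`-LETTERS FOR THE TRIVIAL PHASE**: with `Ψ = 1` the integral of ★ `setIntegral_splitMiddleProfile_balls` is the plain product of
measures `μ(𝔭^{n′})μ(𝔭^{n″})·μ²(U)·μ(𝔭^{n′+k})μ(𝔭^{n″+k})` (★ §1 `setIntegral_splitMiddleProfile_eq` with a vacuous box condition; the dual set is everything).
[cite: WeilBNT1967, Ch. II §5, Prop. 12] -/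
theorem setIntegral_splitMiddleProfile_balls_one {D : K} (n' n'' : ℤ) (k : ℕ) :
    ∫ y in ((((primePowBall K n' ×ˢ primePowBall K n'') \ (primePowBall K (n' + 1) ×ˢ primePowBall K (n'' + 1))) ×ˢ
        (primePowBall K (n' + k) ×ˢ primePowBall K (n'' + k))) ×ˢ (primePowBall K n' ×ˢ primePowBall K n'')),
        ((((1 : AddChar K Circle) (y.2.1 * y.1.1.2 + y.2.2 * y.1.1.1 + D * y.1.2.1 * y.1.2.2) : Circle) : ℂ))
          ∂(((μ.prod μ).prod (μ.prod μ)).prod (μ.prod μ)) =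
      (μ.real (primePowBall K n') : ℂ) * (μ.real (primePowBall K n'') : ℂ) *
        ((μ.prod μ).real ((primePowBall K n' ×ˢ primePowBall K n'') \ (primePowBall K (n' + 1) ×ˢ primePowBall K (n'' + 1))) : ℂ) *
          ((μ.real (primePowBall K (n' + k)) : ℂ) * (μ.real (primePowBall K (n'' + k)) : ℂ)) := by
  haveI : SecondCountableTopology K := secondCountableTopology_localField K
  have hmeas : ∀ j : ℤ, MeasurableSet (primePowBall K j) := fun j => measurableSet_primePowBall j
  have hfinμ : ∀ j : ℤ, μ (primePowBall K j) ≠ ∞ := fun j => (measure_primePowBall_lt_top μ j).ne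
  simp only [AddChar.one_apply, Circle.coe_one]
  rw [setIntegral_const, Complex.real_smul, mul_one, measureReal_prod_prod, measureReal_prod_prod, measureReal_prod_prod, measureReal_prod_prod]
  push_cast
  ring

open scoped Classical in
/-- **THE TWO-DEPTH ROWS OF THE SPLIT HAND, PHASE POSSIBLY TRIVIAL**: as ★ `splitMiddleRows_of_balls`, but `Ψ_x` is only asked to be continuous — where it is
non-trivial its conductor exponent comes from ★ `AddChar.IsContinuousNontrivial.exists_hasConductorExp`, where it is trivial the rows are the plain products
`setIntegral_splitMiddleProfile_balls_one`.  Output: ONE `g` with `F₁(w₁·x) = K·g(x)`, `F₂(w₁·x) = (K·q⁻²)·g(x)` on the cell predicate.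
[cite: Kudla1994, §3 Thm. 3.1] [cite: KudlaSweet1997, §1] [cite: WeilBNT1967, Ch. II §5, Prop. 12] -/
theorem splitMiddleRows_of_balls_or_one (F₁ F₂ : H → ℂ) (w₁ : H) (Kc : ℂ) (c : H → ℂ)
    (Ψ : H → AddChar K Circle) (hΨ : ∀ x, Pred x → Continuous (Ψ x))
    {D : K} (hD : normAbs K D ≤ 1) (n' n'' : H → ℤ) (k : ℕ)
    (hrow₁ : ∀ x, Pred x → F₁ (w₁ * x) =
      Kc * (c x * ∫ y in ((((primePowBall K (n' x) ×ˢ primePowBall K (n'' x)) \ (primePowBall K (n' x + 1) ×ˢ primePowBall K (n'' x + 1))) ×ˢ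
        (primePowBall K (n' x + k) ×ˢ primePowBall K (n'' x + k))) ×ˢ (primePowBall K (n' x) ×ˢ primePowBall K (n'' x))),
        ((Ψ x (y.2.1 * y.1.1.2 + y.2.2 * y.1.1.1 + D * y.1.2.1 * y.1.2.2) : Circle) : ℂ) ∂(((μ.prod μ).prod (μ.prod μ)).prod (μ.prod μ))))
    (hrow₂ : ∀ x, Pred x → F₂ (w₁ * x) =
      Kc * (c x * ∫ y in ((((primePowBall K (n' x) ×ˢ primePowBall K (n'' x)) \ (primePowBall K (n' x + 1) ×ˢ primePowBall K (n'' x + 1))) ×ˢ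
        (primePowBall K (n' x + ((k + 1 : ℕ) : ℤ)) ×ˢ primePowBall K (n'' x + ((k + 1 : ℕ) : ℤ)))) ×ˢ (primePowBall K (n' x) ×ˢ primePowBall K (n'' x))),
        ((Ψ x (y.2.1 * y.1.1.2 + y.2.2 * y.1.1.1 + D * y.1.2.1 * y.1.2.2) : Circle) : ℂ) ∂(((μ.prod μ).prod (μ.prod μ)).prod (μ.prod μ)))) :
    ∃ g : H → ℂ, (∀ x, Pred x → F₁ (w₁ * x) = Kc * g x) ∧
      (∀ x, Pred x → F₂ (w₁ * x) = (Kc * ((residueFieldCard K : ℂ)⁻¹ ^ 2)) * g x) := by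
  -- a conductor exponent where the phase is non-trivial, `0` (unused) where it is trivial
  have hm : ∀ x, Pred x → Ψ x ≠ 1 → ∃ m : ℤ, (Ψ x).HasConductorExp m := fun x hx hne =>
    AddChar.IsContinuousNontrivial.exists_hasConductorExp ⟨hΨ x hx, hne⟩
  choose! m hm using hm
  refine ⟨fun x => if Ψ x = 1 then
      c x * ((μ.real (primePowBall K (n' x)) : ℂ) * (μ.real (primePowBall K (n'' x)) : ℂ) *
        ((μ.prod μ).real ((primePowBall K (n' x) ×ˢ primePowBall K (n'' x)) \ (primePowBall K (n' x + 1) ×ˢ primePowBall K (n'' x + 1))) : ℂ) *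
          ((μ.real (primePowBall K (n' x + k)) : ℂ) * (μ.real (primePowBall K (n'' x + k)) : ℂ)))
    else
      c x * ((μ.real (primePowBall K (n' x)) : ℂ) * (μ.real (primePowBall K (n'' x)) : ℂ) *
        ((μ.prod μ).real (((primePowBall K (n' x) ×ˢ primePowBall K (n'' x)) \ (primePowBall K (n' x + 1) ×ˢ primePowBall K (n'' x + 1))) ∩
            (primePowBall K (m x - n'' x) ×ˢ primePowBall K (m x - n' x))) : ℂ) *
          ((μ.real (primePowBall K (n' x + k)) : ℂ) * (μ.real (primePowBall K (n'' x + k)) : ℂ))), fun x hx => ?_, fun x hx => ?_⟩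
  · dsimp only
    by_cases h1 : Ψ x = 1
    · rw [if_pos h1, hrow₁ x hx, h1, setIntegral_splitMiddleProfile_balls_one μ (n' x) (n'' x) k]
    · rw [if_neg h1, hrow₁ x hx, setIntegral_splitMiddleProfile_balls μ (Ψ x) (hΨ x hx) (hm x hx h1) hD (n' x) (n'' x) k]
  · dsimp only
    have h1' : n' x + ((k + 1 : ℕ) : ℤ) = (n' x + k) + 1 := by push_cast; ring
    have h2' : n'' x + ((k + 1 : ℕ) : ℤ) = (n'' x + k) + 1 := by push_cast; ring
    by_cases h1 : Ψ x = 1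
    · rw [if_pos h1, hrow₂ x hx, h1, setIntegral_splitMiddleProfile_balls_one μ (n' x) (n'' x) (k + 1), h1', h2',
        measureReal_primePowBall_succ_mul μ (n' x + k), measureReal_primePowBall_succ_mul μ (n'' x + k)]
      push_cast
      ring
    · rw [if_neg h1, hrow₂ x hx, setIntegral_splitMiddleProfile_balls μ (Ψ x) (hΨ x hx) (hm x hx h1) hD (n' x) (n'' x) (k + 1), h1', h2',
        measureReal_primePowBall_succ_mul μ (n' x + k), measureReal_primePowBall_succ_mul μ (n'' x + k)]
      push_cast
      ring

end Rows

end Summit.HodgeConjecture.HodgeConjecture.Cruxes.HLiu418.K2LiuSplitMiddleProfileTransport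

end
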